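import Summits.HodgeConjecture.HodgeConjecture.Theorems.CYFormCasimirCYFormSquarePrincipleHgStable
import HarnessLib

/-!
# Crux X3 `CYFormSquarePrinciple` (route `CYFormCasimir`, stmt-HodgeConjecture-23494), helper file 5a:
# cup products of monomials on an eightfold — `T₊ ∪ ⋀⁴W = 0`, `T₊ ∪ h_K⁴ = 0`, `T₊ ∪ (b_J⁻ ∪ b_{Jᶜ}⁻) ≠ 0`,
# the top line `H¹⁶ = ℂ h_K⁸`, and the commutation of `⋀•u` (`u ∈ SU_H(ℂ)`) with the test pull-backs

research route conditional on HC_CM; not a corollary. Nothing here proves HC, HC_CM or any rung.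

Cup-algebra inputs for the Casimir argument (van Geemen LNM 1594, proof of Thm. 6.12; Hatcher §3.2): in the
Weil basis of `H¹(A(ℂ); ℂ)` of an abelian eightfold, the top monomial `T₊ = w₁ ∪ ⋯ ∪ w₈` (`VanGeemen1994.TP`)
kills every monomial containing a `w` — hence `⋀⁴W` and `h_K⁴` (whose coordinates live on the paired
monomials) —, its product with two complementary `w^*`-monomials is `± w₁ ∪ ⋯ ∪ w₈ ∪ w*₁ ∪ ⋯ ∪ w*₈ ≠ 0`, the
top cohomology `H¹⁶(A(ℂ); ℂ)` is the line `ℂ h_K⁸` (so `⋀¹⁶u = id` on it for `u ∈ SU_H(ℂ)` when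
`Hg = SU_H`), and `⋀•u` commutes with every test pull-back `(x·𝟙 + y·φ)^*` (so preserves `⋀⁴W`, `⋀⁴W^*`).

References: vanGeemen1994HodgeAV (Lemma 6.10, proof of Thm. 6.12), HatcherAT2002 (§3.2), LangeBirkenhake1992
(Lemma 1.1.17, Exercise 1.1.6).
-/

-- `Summit.HodgeConjecture.HodgeConjecture.…` is the tree's mandated summit/problem namespace (single-problem summit).
set_option linter.dupNamespace false
noncomputable section

open CategoryTheory
open Literature.AlgebraicTopology.SingularHomology
open Literature.AlgebraicGeometry.Motives
open Literature.AlgebraicGeometry.HodgeTheory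
open Literature.AlgebraicGeometry.VanGeemen1994

namespace Summit.HodgeConjecture.HodgeConjecture.Theorems.CYFormSquare

/-! ### Generic cup-product lemmas for monomials -/

section Generic

variable {Y : Type} [TopologicalSpace Y]

/-- `(v₁ ∪ ⋯ ∪ v_d) ∪ (w₁ ∪ ⋯ ∪ w_e) = v₁ ∪ ⋯ ∪ w_e` with a free target degree. [cite: HatcherAT2002, §3.2] -/
theorem cupProduct_cupPowOne_cupPowOne_cast {d e m : ℕ} (h : d + e = m) (v : Fin d → singularCohomology ℂ ℂ Y 1)
    (w : Fin e → singularCohomology ℂ ℂ Y 1) :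
    cupProduct h (cupPowOne ℂ Y d v) (cupPowOne ℂ Y e w) = cupPowOne ℂ Y m (Fin.append v w ∘ Fin.cast h.symm) := by
  subst h
  rw [cupProduct_cupPowOne_cupPowOne]
  rfl

/-- A product of two iterated products of degree-one classes sharing a factor vanishes. [folklore] -/
theorem cupProduct_cupPowOne_cupPowOne_eq_zero {d e m : ℕ} (h : d + e = m) (v : Fin d → singularCohomology ℂ ℂ Y 1)
    (w : Fin e → singularCohomology ℂ ℂ Y 1) (i : Fin d) (j : Fin e) (hij : v i = w j) :
    cupProduct h (cupPowOne ℂ Y d v) (cupPowOne ℂ Y e w) = 0 := by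
  subst h
  rw [cupProduct_cupPowOne_cupPowOne]
  refine cupPowOne_eq_zero_of_eq _ _ (Fin.castAdd e i) (Fin.natAdd d j) ?_ ?_
  · rw [Fin.append_left, Fin.append_right, hij]
  · intro hc
    have := congrArg Fin.val hc
    simp [Fin.val_castAdd, Fin.val_natAdd] at this
    omega

end Generic

/-! ### Monomials on an abelian variety -/

section Monomials

variable {A : AbelianVariety ℂ} {N : ℕ}

/-- **Two monomials sharing an index multiply to zero.** [cite: LangeBirkenhake1992, Lemma 1.1.17] -/
theorem cupProduct_monB_monB_eq_zero_of_mem (b : Module.Basis (Fin N) ℂ (complexBetti A.X 1)) {q q' m : ℕ}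
    (h : q + q' = m) (s : Set.powersetCard (Fin N) q) (s' : Set.powersetCard (Fin N) q') {j : Fin N}
    (hj : j ∈ s.val) (hj' : j ∈ s'.val) : cupProduct h (monB b q s) (monB b q' s') = 0 := by
  rw [monB_apply, monB_apply]
  obtain ⟨r, hr⟩ : j ∈ Set.range (s.val.orderEmbOfFin s.prop) := by rw [Finset.range_orderEmbOfFin]; exact hj
  obtain ⟨r', hr'⟩ : j ∈ Set.range (s'.val.orderEmbOfFin s'.prop) := by rw [Finset.range_orderEmbOfFin]; exact hj'
  exact cupProduct_cupPowOne_cupPowOne_eq_zero h _ _ r r' (by rw [hr, hr'])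

/-- **The exterior action is functorial**: `⋀•(L₁ ∘ L₂) = ⋀•L₁ ∘ ⋀•L₂`. [cite: HatcherAT2002, §3.2 Example 3.16] -/
theorem extAct_comp (L₁ L₂ : complexBetti A.X 1 →ₗ[ℂ] complexBetti A.X 1) (q : ℕ) :
    extAct (L₁ ∘ₗ L₂) q = extAct L₁ q ∘ₗ extAct L₂ q := by
  refine exteriorPullback_ext (hasExteriorCohomologyH1 A) fun v ↦ ?_
  rw [LinearMap.comp_apply, extAct_cupPowOne, extAct_cupPowOne, extAct_cupPowOne]
  rfl

/-- **`⋀•u` commutes with the test pull-backs `(x·𝟙 + y·φ)^*` when `u` commutes with `φ^*`** (both are exterior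
actions of degree-one operators which commute). [cite: vanGeemen1994HodgeAV, 6.9–6.10] -/
theorem extAct_testOp_comm {φ : A ⟶ A} {u : complexBetti A.X 1 →ₗ[ℂ] complexBetti A.X 1}
    (hc : ∀ c, u (pullbackOne A φ c) = pullbackOne A φ (u c)) (x y q : ℕ) (z : complexBetti A.X q) :
    extAct u q (complexBetti.map (x • 𝟙 A + y • φ).hom.hom.hom q z) =
      complexBetti.map (x • 𝟙 A + y • φ).hom.hom.hom q (extAct u q z) := by
  have hψ : u ∘ₗ (complexBetti.map (x • 𝟙 A + y • φ).hom.hom.hom 1).hom =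
      (complexBetti.map (x • 𝟙 A + y • φ).hom.hom.hom 1).hom ∘ₗ u := by
    refine LinearMap.ext fun c ↦ ?_
    rw [LinearMap.comp_apply, LinearMap.comp_apply]
    change u (complexBetti.map (x • 𝟙 A + y • φ).hom.hom.hom 1 c) = complexBetti.map (x • 𝟙 A + y • φ).hom.hom.hom 1 (u c)
    rw [complexBetti_map_nsmul_id_add_nsmul_one, complexBetti_map_nsmul_id_add_nsmul_one, map_add, map_smul, map_smul]
    exact congrArg _ (congrArg _ (hc c))
  change extAct u q ((complexBetti.map (x • 𝟙 A + y • φ).hom.hom.hom q).hom z) =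
    (complexBetti.map (x • 𝟙 A + y • φ).hom.hom.hom q).hom (extAct u q z)
  rw [testOp_eq_extAct, ← LinearMap.comp_apply, ← extAct_comp, hψ, extAct_comp, LinearMap.comp_apply]

/-- `⋀•u` preserves every joint eigenclass space of the test pull-backs (e.g. `⋀⁴W`, `⋀⁴W^*`) when `u` commutes
with `φ^*`. [cite: vanGeemen1994HodgeAV, Lemma 6.10] -/
theorem extAct_mem_pullbackEigenclasses {φ : A ⟶ A} {u : complexBetti A.X 1 →ₗ[ℂ] complexBetti A.X 1}
    (hc : ∀ c, u (pullbackOne A φ c) = pullbackOne A φ (u c)) {q : ℕ} {χ : ℕ → ℕ → ℂ} {z : complexBetti A.X q}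
    (hz : z ∈ pullbackEigenclasses A φ q χ) : extAct u q z ∈ pullbackEigenclasses A φ q χ := by
  rw [mem_pullbackEigenclasses_iff] at hz ⊢
  intro x y
  have h := extAct_testOp_comm hc x y q z
  change _ = singularCohomology.map ℂ ℂ _ q (extAct u q z) at h
  rw [← h]
  change extAct u q (singularCohomology.map ℂ ℂ _ q z) = _
  rw [hz x y, map_smul]

end Monomials

/-! ### The eightfold: `T₊` against `⋀⁴W`, `h_K⁴`, and two complementary `w^*`-monomials; the top line -/

section Eightfold

variable {A : AbelianVariety ℂ} {d : ℕ} {φ : A ⟶ A}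
variable (hn : 2 ≤ 4) (hd : 0 < d) (hA : A.dim = 2 * 4) (hφ : φ ≫ φ = -(d • 𝟙 A))
  (e : ProjectiveEmbedding A.X) {a : complexBetti (projectiveSpace e.n ℂ) 2} (ha : IsRationalClass a)
  (ha0 : a ≠ 0)

/-- **`T₊ ∪ x = 0` for `x ∈ ⋀⁴W`**: every monomial of `⋀⁴W` shares a `w`-factor with `T₊ = w₁ ∪ ⋯ ∪ w₈`.
[cite: vanGeemen1994HodgeAV, proof of Thm. 6.12] -/
theorem TP_cup_eq_zero_of_mem_weilClassesPlus {m : ℕ} (h : 2 * 4 + 2 * 2 = m) {x : complexBetti A.X (2 * 2)}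
    (hx : x ∈ weilClassesPlus A φ 2 d) : cupProduct h (TP hn hd hA hφ e ha ha0) x = 0 := by
  have hx' := weilClassesPlus_two_le_span hn hd hA hφ e ha ha0 hx
  clear hx
  induction hx' using Submodule.span_induction with
  | mem x hx =>
    obtain ⟨I, rfl⟩ := hx
    obtain ⟨i, hi⟩ : I.val.Nonempty := by
      rw [← Finset.card_pos, Set.powersetCard.card_eq]; norm_num
    refine cupProduct_monB_monB_eq_zero_of_mem _ h _ _ (j := Fin.castAdd (2 * 4) i) ?_ ?_
    · exact castAdd_mem_map_castAddEmb_iff.2 (Finset.mem_univ i)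
    · rw [Set.powersetCard.val_map]; exact castAdd_mem_map_castAddEmb_iff.2 hi
  | zero => rw [map_zero]
  | add x y _ _ hx hy => rw [map_add, hx, hy, add_zero]
  | smul c x _ hx => rw [map_smul, hx, smul_zero]

/-- A top-plus index set is `topPlusIdx` (the tree's lemma is private). [folklore] -/
theorem eq_topPlusIdx_of_isTopPlus' {k : ℕ} {s : Set.powersetCard (Fin (k + k)) k} (hs : IsTopPlus s.val) :
    s = topPlusIdx k := by
  apply Subtype.ext; ext p
  refine Fin.addCases (fun i ↦ ?_) (fun j ↦ ?_) p
  · exact ⟨fun _ ↦ castAdd_mem_map_castAddEmb_iff.2 (Finset.mem_univ i), fun _ ↦ (hs i).1⟩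
  · exact ⟨fun h ↦ absurd h (hs j).2, fun h ↦ absurd h natAdd_not_mem_map_castAddEmb'⟩

/-- A top-minus index set is `topMinusIdx`. [folklore] -/
theorem eq_topMinusIdx_of_isTopMinus' {k : ℕ} {s : Set.powersetCard (Fin (k + k)) k} (hs : IsTopMinus s.val) :
    s = topMinusIdx k := by
  apply Subtype.ext; ext p
  refine Fin.addCases (fun i ↦ ?_) (fun j ↦ ?_) p
  · exact ⟨fun h ↦ absurd h (hs i).2, fun h ↦ absurd h castAdd_not_mem_map_natAddEmb'⟩
  · exact ⟨fun _ ↦ natAdd_mem_map_natAddEmb_iff.2 (Finset.mem_univ j), fun _ ↦ (hs j).1⟩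

include hn hA ha ha0 in
/-- **`T₊ ∪ h_K⁴ = 0`** when `Hg = SU_H`: the coordinates of `h_K⁴` live on the paired monomials (torus invariance,
the tree's `repr_eq_zero_of_not_isPaired`) and vanish at the tops (`repr_cupPowTwo_hK_top{Plus,Minus}Idx`); a
paired monomial of degree `8` contains a `w`-factor. [cite: vanGeemen1994HodgeAV, proof of Thm. 6.12] -/
theorem TP_cup_cupPowTwo_hK_eq_zero (hSU : HasHodgeGroupSU A φ 4 d (hK d φ e a)) {m : ℕ} (h : 2 * 4 + 2 * 4 = m) :
    cupProduct h (TP hn hd hA hφ e ha ha0) (cupPowTwo (hK d φ e a) 4) = 0 := by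
  classical
  set B := monB (bW hn hd hA hφ e ha ha0) (2 * 4) with hB
  have hmem : cupPowTwo (hK d φ e a) 4 ∈ hodgeClassSpan A.dim A.X 4 := cupPowTwo_hK_mem_hodgeClassSpan hn hd hA e ha ha0 4
  conv_lhs => rw [← B.sum_repr (cupPowTwo (hK d φ e a) 4)]
  rw [map_sum]
  refine Finset.sum_eq_zero fun s _ ↦ ?_
  rw [map_smul]
  by_cases hp : IsPaired s.val
  · -- a paired set of size `8` contains some `castAdd i`
    obtain ⟨i, hi⟩ : ∃ i, Fin.castAdd (2 * 4) i ∈ s.val := by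
      by_contra hne
      simp only [not_exists] at hne
      have hs0 : s.val = ∅ := by
        refine Finset.eq_empty_of_forall_notMem fun p ↦ Fin.addCases (fun i ↦ hne i) (fun j hj ↦ hne j ((hp j).2 hj)) p
      have := s.prop; rw [Set.powersetCard.mem_iff, hs0, Finset.card_empty] at this; omega
    rw [hB, cupProduct_monB_monB_eq_zero_of_mem _ h _ _ (j := Fin.castAdd (2 * 4) i)
      (castAdd_mem_map_castAddEmb_iff.2 (Finset.mem_univ i)) hi, smul_zero]
  by_cases ht : IsTopPlus s.val ∨ IsTopMinus s.val
  · rcases ht with ht | ht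
    · rw [eq_topPlusIdx_of_isTopPlus' ht, hB, repr_cupPowTwo_hK_topPlusIdx hn hd hA hφ e ha ha0 hSU, zero_smul]
    · rw [eq_topMinusIdx_of_isTopMinus' ht, hB, repr_cupPowTwo_hK_topMinusIdx hn hd hA hφ e ha ha0 hSU, zero_smul]
  · obtain ⟨ht1, ht2⟩ := not_or.1 ht
    rw [hB, repr_eq_zero_of_not_isPaired (m := 2 * 4 - 1) (by omega) (by omega) hd hφ e ha ha0 (wBasis hd hφ hA) _
      (fun _ _ hne ↦ extAct_torusAuto_of_mem hn hd hA hφ e ha ha0 hSU hmem hne) s hp ht1 ht2, zero_smul]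

/-- **`T₊ ∪ (b_J⁻ ∪ b_{J'}⁻) ≠ 0` for complementary `J, J'`**: the `16` factors are the whole Weil basis in some
order. [cite: LangeBirkenhake1992, Lemma 1.1.17 and Exercise 1.1.6 (8)] -/
theorem TP_cup_monB_cup_monB_ne_zero (J J' : Set.powersetCard (Fin (2 * 4)) (2 * 2)) (hJ : J'.val = J.valᶜ)
    (h₁ : 2 * 2 + 2 * 2 = 2 * 4) (h₂ : 2 * 4 + 2 * 4 = 2 * 8) :
    cupProduct h₂ (TP hn hd hA hφ e ha ha0)
      (cupProduct h₁ (monB (bW hn hd hA hφ e ha ha0) (2 * 2) (Set.powersetCard.map (2 * 2) (Fin.natAddEmb (2 * 4)) J))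
        (monB (bW hn hd hA hφ e ha ha0) (2 * 2) (Set.powersetCard.map (2 * 2) (Fin.natAddEmb (2 * 4)) J'))) ≠ 0 := by
  classical
  set b := bW hn hd hA hφ e ha ha0 with hb
  set sJ := Set.powersetCard.map (2 * 2) (Fin.natAddEmb (2 * 4)) J with hsJ
  set sJ' := Set.powersetCard.map (2 * 2) (Fin.natAddEmb (2 * 4)) J' with hsJ'
  set f₀ : Fin (2 * 4) → Fin (2 * 4 + 2 * 4) := fun r ↦ (topPlusIdx (2 * 4)).val.orderEmbOfFin (topPlusIdx (2 * 4)).prop r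
  set f₁ : Fin (2 * 2) → Fin (2 * 4 + 2 * 4) := fun r ↦ sJ.val.orderEmbOfFin sJ.prop r
  set f₂ : Fin (2 * 2) → Fin (2 * 4 + 2 * 4) := fun r ↦ sJ'.val.orderEmbOfFin sJ'.prop r
  set F : Fin (2 * 8) → Fin (2 * 4 + 2 * 4) := Fin.append f₀ (Fin.append f₁ f₂ ∘ Fin.cast h₁.symm) ∘ Fin.cast h₂.symm with hF
  -- the product is the iterated product of `b ∘ F`
  have hprod : cupProduct h₂ (TP hn hd hA hφ e ha ha0) (cupProduct h₁ (monB b (2 * 2) sJ) (monB b (2 * 2) sJ')) =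
      cupPowOne ℂ (ComplexPoints A.X) (2 * 8) (b ∘ F) := by
    rw [TP, monB_apply, monB_apply, monB_apply, cupProduct_cupPowOne_cupPowOne_cast h₁,
      cupProduct_cupPowOne_cupPowOne_cast h₂]
    congr 1
    funext r
    simp only [hF, Function.comp_apply]
    refine Fin.addCases (fun i ↦ ?_) (fun i ↦ ?_) (Fin.cast h₂.symm r)
    · rw [Fin.append_left, Fin.append_left]
    · rw [Fin.append_right, Fin.append_right, Function.comp_apply, Function.comp_apply]
      refine Fin.addCases (fun i' ↦ ?_) (fun i' ↦ ?_) (Fin.cast h₁.symm i)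
      · rw [Fin.append_left, Fin.append_left]
      · rw [Fin.append_right, Fin.append_right]
  -- `F` is a bijection
  have hmem₀ : ∀ r, ∃ i, f₀ r = Fin.castAdd (2 * 4) i := fun r ↦ by
    have h := (topPlusIdx (2 * 4)).val.orderEmbOfFin_mem (topPlusIdx (2 * 4)).prop r
    change f₀ r ∈ (Finset.univ : Finset (Fin (2 * 4))).map (Fin.castAddEmb (2 * 4)) at h
    obtain ⟨i, -, hi⟩ := Finset.mem_map.1 h
    exact ⟨i, hi.symm⟩
  have hmem₁ : ∀ r, ∃ j ∈ J.val, f₁ r = Fin.natAdd (2 * 4) j := fun r ↦ by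
    have h : f₁ r ∈ J.val.map (Fin.natAddEmb (2 * 4)) := sJ.val.orderEmbOfFin_mem sJ.prop r
    obtain ⟨j, hj, hj'⟩ := Finset.mem_map.1 h
    exact ⟨j, hj, hj'.symm⟩
  have hmem₂ : ∀ r, ∃ j ∈ J'.val, f₂ r = Fin.natAdd (2 * 4) j := fun r ↦ by
    have h : f₂ r ∈ J'.val.map (Fin.natAddEmb (2 * 4)) := sJ'.val.orderEmbOfFin_mem sJ'.prop r
    obtain ⟨j, hj, hj'⟩ := Finset.mem_map.1 h
    exact ⟨j, hj, hj'.symm⟩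
  -- `Fin.append` of injective families with disjoint ranges is injective
  have happ : ∀ {m n : ℕ} {f : Fin m → Fin (2 * 4 + 2 * 4)} {g : Fin n → Fin (2 * 4 + 2 * 4)},
      Function.Injective f → Function.Injective g → (∀ i j, f i ≠ g j) → Function.Injective (Fin.append f g) := by
    intro m n f g hf hg hfg a b hab
    induction a using Fin.addCases with
    | left a =>
      induction b using Fin.addCases with
      | left b => rw [Fin.append_left, Fin.append_left] at hab; rw [hf hab]
      | right b => rw [Fin.append_left, Fin.append_right] at hab; exact absurd hab (hfg a b)
    | right a =>
      induction b using Fin.addCases with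
      | left b => rw [Fin.append_right, Fin.append_left] at hab; exact absurd hab.symm (hfg b a)
      | right b => rw [Fin.append_right, Fin.append_right] at hab; rw [hg hab]
  have hinj : Function.Injective F := by
    rw [hF]
    refine (Function.Injective.comp ?_ (Fin.cast_injective _))
    refine happ (fun a b hab ↦ (Finset.orderEmbOfFin _ _).injective hab) ?_ ?_
    · refine Function.Injective.comp (happ (fun a b hab ↦ (Finset.orderEmbOfFin _ _).injective hab)
        (fun a b hab ↦ (Finset.orderEmbOfFin _ _).injective hab) fun i j hij ↦ ?_) (Fin.cast_injective _)
      obtain ⟨j₁, hj₁, h1⟩ := hmem₁ i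
      obtain ⟨j₂, hj₂, h2⟩ := hmem₂ j
      rw [h1, h2] at hij
      have := Fin.natAdd_injective _ _ hij
      rw [hJ, Finset.mem_compl] at hj₂
      exact hj₂ (this ▸ hj₁)
    · intro i j
      obtain ⟨i₀, hi₀⟩ := hmem₀ i
      rw [hi₀, Function.comp_apply]
      generalize Fin.cast h₁.symm j = j'
      induction j' using Fin.addCases with
      | left j'' =>
        rw [Fin.append_left]
        obtain ⟨j₁, -, h1⟩ := hmem₁ j''
        rw [h1]; exact castAdd_ne_natAdd' i₀ j₁
      | right j'' =>
        rw [Fin.append_right]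
        obtain ⟨j₂, -, h2⟩ := hmem₂ j''
        rw [h2]; exact castAdd_ne_natAdd' i₀ j₂
  have hbij : Function.Bijective F := (Fintype.bijective_iff_injective_and_card F).2 ⟨hinj, by simp⟩
  set σ := Equiv.ofBijective F hbij with hσ
  have hbF : b ∘ F = ⇑(b.reindex σ.symm) := by
    funext r; rw [Function.comp_apply, Module.Basis.reindex_apply, Equiv.symm_symm, Equiv.ofBijective_apply]
  rw [hprod, hbF]
  exact cupPowOne_basis_ne_zero (hasExteriorCohomologyH1 A) _

include hn hd hA hφ e ha ha0 in
/-- **The top cohomology of the eightfold is the line `ℂ h_K⁸`.** [cite: vanGeemen1994HodgeAV, proof of Thm. 6.12 ("`⋀^{2n}W ≅ ℂ`")] -/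
theorem exists_smul_cupPowTwo_hK_eight_eq (hSU : HasHodgeGroupSU A φ 4 d (hK d φ e a)) (w : complexBetti A.X (2 * 8)) :
    ∃ c : ℂ, c • cupPowTwo (hK d φ e a) 8 = w := by
  haveI := finite_complexBetti_abelianVariety A (2 * 8)
  have h1 : Module.finrank ℂ (complexBetti A.X (2 * 8)) = 1 := by
    rw [abelianVarietyCohomologyExteriorH1_holds.finrank_eq A (2 * 8), hA]; decide
  exact (finrank_eq_one_iff_of_nonzero' _ (cupPowTwo_hK_ne_zero hn hd hA hφ e ha ha0 hSU (p := 8) (by norm_num))).1 h1 w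

include hn hd hA hφ e ha ha0 in
/-- **`⋀¹⁶u = id` on `H¹⁶(A(ℂ); ℂ)` for `u ∈ SU_H(ℂ)`** when `Hg = SU_H` (`h_K⁸` is a Hodge class, fixed by `Hg`).
[cite: vanGeemen1994HodgeAV, 6.4–6.7] -/
theorem extAct_top_eq_self (hSU : HasHodgeGroupSU A φ 4 d (hK d φ e a)) {u : complexBetti A.X 1 ≃ₗ[ℂ] complexBetti A.X 1}
    (hu : u ∈ weilSpecialUnitaryGroup A φ 4 d (hK d φ e a)) (w : complexBetti A.X (2 * 8)) :
    extAct (u : complexBetti A.X 1 →ₗ[ℂ] complexBetti A.X 1) (2 * 8) w = w := by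
  obtain ⟨c, rfl⟩ := exists_smul_cupPowTwo_hK_eight_eq hn hd hA hφ e ha ha0 hSU w
  rw [map_smul, extAct_eq_self_of_mem_hodgeClassSpan hSU hu (cupPowTwo_hK_mem_hodgeClassSpan hn hd hA e ha ha0 8)]

include hn hd hA hφ e ha ha0 in
/-- A linear functional on the top line which does not kill `h_K⁸` kills only `0`. [folklore] -/
theorem eq_zero_of_apply_eq_zero_of_apply_hK_ne (hSU : HasHodgeGroupSU A φ 4 d (hK d φ e a))
    (ℓ : complexBetti A.X (2 * 8) →ₗ[ℂ] ℂ) (hℓ : ℓ (cupPowTwo (hK d φ e a) 8) ≠ 0) {w : complexBetti A.X (2 * 8)}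
    (hw : ℓ w = 0) : w = 0 := by
  obtain ⟨c, rfl⟩ := exists_smul_cupPowTwo_hK_eight_eq hn hd hA hφ e ha ha0 hSU w
  rw [map_smul, smul_eq_mul] at hw
  rw [(mul_eq_zero.1 hw).resolve_right hℓ, zero_smul]

end Eightfold

end Summit.HodgeConjecture.HodgeConjecture.Theorems.CYFormSquare

end
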